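import Mathlib
import HarnessLib
import Summits.NavierStokesRegularity.NavierStokesRegularity.Theorems.TypeIQuarterGateScarEnvelopeTypeIForcedTsaiDefs

/-!
# ARM B, lane E-exact — CERTIFICATE ROWS for `ForcedTsaiModulusLE`, TYPE-I-TAIL class («LANEX-ALG»):
  polynomial × algebraic-kernel witnesses with exact far-field closure, exact Beta/Gamma moments
  (ns-wall-extremal ARM B; eng-5 design note `ARM-B/w5/LANEX-ALG-FORMAT-NOTE.md`, cert hand ns-crc-p2 g5)

WHY A SECOND CLASS.  The polynomial × Gaussian rows of `…ForcedTsaiCert` are kernel theorems but sit at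
`δ/M ≈ 40` (level 16) / `≈ 39` (level 4): Gaussian tails violate the Leray scaling `Ω + ½y·∇Ω = 0` at
infinity, and removing the `(−1)`-homogeneous tail lifts the linear floor from `14.86` to `27.9`
(eng-3 README §6).  Near-floor witnesses have TYPE-I tails `|U| ~ c/|y|`; in the tree currency
(`‖(1+ρ)^{5/2} g‖_{L²(ℝ³)}`) such a witness must moreover carry the exact FAR-FIELD CLOSURE `U₋₃`
(else `g = O(ρ⁻⁴)` and the weighted residual diverges logarithmically).

ROW OF RECORD (`AlgRow`): `{τ, Ψ, mF, kF, r₁, r₃, r₅, M, δ}` — scale `τ ∈ ℚ₊`, a symbolic vector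
potential `Ψ` = three sparse «5-monomial» lists, monomials `c·y₁^a₁ y₂^a₂ y₃^a₃ · t^k · v^h` with
`t := |y|²`, `v := (1 + |y|²/τ²)^{−1/2}` (so `v^h = W^{h/2}`, `W = (1+|y|²/τ²)^{−1}`; half-integer powers
of `W` carry the `ℓ = 1` Type-I far field, integer powers its closure), floor parameters `mF, kF ∈ ℕ`,
AM-GM radii `r₁,r₃,r₅ ∈ ℚ₊` of the even weight majorant, claimed level floor `M`, residual ceiling `δ`.
The WITNESS is `U := curl Ψ` (divergence-free, smooth — `1 + |y|²/τ² > 0`).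

EXACT PIPELINE (all in `ℚ`; mirror `pub-ns-dss/wall-extremal/arm-B/alg/algcert.py`):
`∂_j (y^a t^k v^h) = a_j y^{a−e_j} t^k v^h + 2k·y_j y^a t^{k−1} v^h − (h/τ²)·y_j y^a t^k v^{h+2}`;
`u := curl Ψ`, `ω := curl u`, `f := −Δu + ½u + ½(y·∇)u`, `n := (u·∇)u`, `g := curl f + curl n`
(`g` = the vorticity residual `lerayVorticityResidual U`), then the NORMAL FORM `gNF` of `g` under the
value-preserving rewrites `y₃² → t − y₁² − y₂²`, `t·v² → τ²(1 − v²)` — this is what makes the Leray-scaling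
cancellation (`(1 + ½y·∇)ρ⁻² = 0`) and the closure cancellation (degree `−4`) EXACT polynomial arithmetic,
so that every surviving monomial of `gNF` decays like the true `g` (`O(ρ⁻⁶)` for a closed Type-I row).
LEVEL floor `lev2 := ∫ φ·|ω|²`, `φ = NF[(1 − (t/100)^{mF})·(1 − (1−v²)^{kF})^{mF}]` (`≤ 𝟙_{B₁₀}`:
both factors lie in `[0,1]` on `B₁₀`, the first is `≤ 0` outside).  RESIDUAL ceiling
`res2 := ∫ m·Σᵢ gNFᵢ²`, `m = 1 + 10t + 5t² + 5B₁ + 10B₃ + B₅`, `B_j = (r_j ρ^{j−1} + ρ^{j+1}/r_j)/2 ≥ ρ^j`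
(AM-GM, even in `ρ`), so `m(y) ≥ (1+|y|)⁵`.  MOMENTS: every integrand monomial must satisfy
`h > |a| + 2k + 3` (absolute convergence, checked); `t^k` is expanded into `y`-monomials and
`∫_{ℝ³} y^a v^h dy = [all aᵢ even]·Πᵢ Γ((aᵢ+1)/2)·τ^{|a|+3}·Γ((h−|a|−3)/2)/Γ(h/2) ∈ ℚ·π² (h even) / ℚ·π (h odd)`
(Gamma subordination of the Gaussian moments).  CHECK: `0 < τ, rⱼ`, `0 ≤ M, δ`,
`M² ≤ lo(lev2)`, `hi(res2) ≤ δ²` with termwise-signed rational enclosures of `π`, `π²`.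
The kernel SOUNDNESS theorem `AlgRow.sound : r.check = true → ForcedTsaiModulusLE r.M r.δ` is NOT in this
file (separate modules: semantics, calculus of `v^h`, the moment identity, composition); until it lands a
passing row is a kernel-REPLAYED exact computation whose meaning is the displayed inequalities.

NUMBERS (mirror, row `l=1 poloidal Type-I + closure`, τ = 3, 8 half-integer powers): certified
`δ/M ≤ 17.0` at `M = 1/4` (exact-currency float 14.95; engines' B₄₀ floor 14.86; Gaussian class ≈ 39–40).
HONEST FRAMING: an UPPER bound on the forced-Tsai modulus («near-profiles this good exist»), never an
exclusion; MODEL/certificate-level; nothing here bears on Navier–Stokes regularity; 23843 / H3 OPEN.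
-/

set_option linter.dupNamespace false

namespace Summit.NavierStokesRegularity.NavierStokesRegularity.Cruxes.ScarEnvelopeTypeI.ForcedTsai

/-! ## Sparse «5-monomials» `c · y₁^e₁ y₂^e₂ y₃^e₃ · t^et · v^eh` over `ℚ` -/

/-- A monomial `c · y₁^e1 y₂^e2 y₃^e3 · t^et · v^eh` (`t = |y|²`, `v = (1+|y|²/τ²)^{−1/2}`). -/
structure Mono5 where
  /-- exponent of `y₁` -/ e1 : ℕ
  /-- exponent of `y₂` -/ e2 : ℕ
  /-- exponent of `y₃` -/ e3 : ℕ
  /-- exponent of `t = |y|²` -/ et : ℕ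
  /-- exponent of `v = (1+|y|²/τ²)^{−1/2}` -/ eh : ℕ
  /-- coefficient -/ c : ℚ
  deriving DecidableEq, Repr

/-- A sparse 5-polynomial = a list of 5-monomials (its value is the SUM; duplicates allowed). -/
abbrev Poly5 := List Mono5

namespace Mono5

/-- Exponent of the variable `y_j`. -/
def exp (m : Mono5) (j : Fin 3) : ℕ := match j with | 0 => m.e1 | 1 => m.e2 | 2 => m.e3

/-- Sorting / combining key. -/
def key (m : Mono5) : ℕ × ℕ × ℕ × ℕ × ℕ := (m.e1, m.e2, m.e3, m.et, m.eh)

/-- Product. -/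
def mul (m m' : Mono5) : Mono5 :=
  ⟨m.e1 + m'.e1, m.e2 + m'.e2, m.e3 + m'.e3, m.et + m'.et, m.eh + m'.eh, m.c * m'.c⟩

/-- Multiply by `y_j`. -/
def mulVar (j : Fin 3) (m : Mono5) : Mono5 :=
  match j with
  | 0 => { m with e1 := m.e1 + 1 }
  | 1 => { m with e2 := m.e2 + 1 }
  | 2 => { m with e3 := m.e3 + 1 }

/-- `y`-part of `∂_j`: `a_j · y^{a − e_j} t^k v^h` (`none` if `a_j = 0`). -/
def derivY (j : Fin 3) (m : Mono5) : Option Mono5 :=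
  match j with
  | 0 => if m.e1 = 0 then none else some { m with e1 := m.e1 - 1, c := m.c * m.e1 }
  | 1 => if m.e2 = 0 then none else some { m with e2 := m.e2 - 1, c := m.c * m.e2 }
  | 2 => if m.e3 = 0 then none else some { m with e3 := m.e3 - 1, c := m.c * m.e3 }

/-- `t`-part of `∂_j`: `2k · y_j y^a t^{k−1} v^h` (`none` if `k = 0`). -/
def derivT (j : Fin 3) (m : Mono5) : Option Mono5 :=
  if m.et = 0 then none else some (mulVar j { m with et := m.et - 1, c := m.c * (2 * m.et) })

/-- `v`-part of `∂_j`: `−(h/τ²) · y_j y^a t^k v^{h+2}` (`none` if `h = 0`). -/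
def derivV (τ2 : ℚ) (j : Fin 3) (m : Mono5) : Option Mono5 :=
  if m.eh = 0 then none else some (mulVar j { m with eh := m.eh + 2, c := -(m.c * m.eh / τ2) })

end Mono5

namespace Poly5

/-- Sum. -/
def add (P Q : Poly5) : Poly5 := P ++ Q
/-- Scalar multiple. -/
def scale (c : ℚ) (P : Poly5) : Poly5 := P.map fun m => { m with c := c * m.c }
/-- Difference. -/
def sub (P Q : Poly5) : Poly5 := add P (scale (-1) Q)
/-- Multiply by `y_j`. -/
def mulVar (j : Fin 3) (P : Poly5) : Poly5 := P.map (Mono5.mulVar j)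
/-- Product (unnormalised). -/
def mul (P Q : Poly5) : Poly5 := P.flatMap fun m => Q.map (Mono5.mul m)

/-- Combine ADJACENT monomials with equal keys (after sorting) and drop zeros. -/
def combine : Poly5 → Poly5
  | [] => []
  | [m] => if m.c = 0 then [] else [m]
  | m :: m' :: rest =>
    if m.key = m'.key then combine ({ m with c := m.c + m'.c } :: rest)
    else if m.c = 0 then combine (m' :: rest) else m :: combine (m' :: rest)
  termination_by P => P.length

/-- Lexicographic order on keys as a Boolean. -/
def keyLE (m m' : Mono5) : Bool :=
  decide (m.e1 < m'.e1 ∨ (m.e1 = m'.e1 ∧ (m.e2 < m'.e2 ∨ (m.e2 = m'.e2 ∧ (m.e3 < m'.e3 ∨ (m.e3 = m'.e3 ∧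
    (m.et < m'.et ∨ (m.et = m'.et ∧ m.eh ≤ m'.eh))))))))

/-- Normal form of the LIST (sort, combine like terms; value-preserving). -/
def norm (P : Poly5) : Poly5 := combine (P.mergeSort keyLE)

/-- Normalised product. -/
def nmul (P Q : Poly5) : Poly5 := norm (mul P Q)

/-- Partial derivative `∂_j` at scale `τ² = τ2` (the three product-rule parts). -/
def deriv (τ2 : ℚ) (j : Fin 3) (P : Poly5) : Poly5 :=
  P.filterMap (Mono5.derivY j) ++ P.filterMap (Mono5.derivT j) ++ P.filterMap (Mono5.derivV τ2 j)

end Poly5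

/-! ## Symbolic vector calculus (coefficient level) -/

/-- Symbolic curl. -/
def curl5 (τ2 : ℚ) (V : Fin 3 → Poly5) : Fin 3 → Poly5 :=
  ![Poly5.norm (Poly5.sub (Poly5.deriv τ2 1 (V 2)) (Poly5.deriv τ2 2 (V 1))),
    Poly5.norm (Poly5.sub (Poly5.deriv τ2 2 (V 0)) (Poly5.deriv τ2 0 (V 2))),
    Poly5.norm (Poly5.sub (Poly5.deriv τ2 0 (V 1)) (Poly5.deriv τ2 1 (V 0)))]

/-- Symbolic Laplacian `Σ_j ∂_j∂_j`. -/
def lap5 (τ2 : ℚ) (P : Poly5) : Poly5 :=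
  Poly5.add (Poly5.add (Poly5.deriv τ2 0 (Poly5.deriv τ2 0 P)) (Poly5.deriv τ2 1 (Poly5.deriv τ2 1 P)))
    (Poly5.deriv τ2 2 (Poly5.deriv τ2 2 P))

/-- Symbolic `(y·∇)P = Σ_j y_j ∂_j P`. -/
def ydot5 (τ2 : ℚ) (P : Poly5) : Poly5 :=
  Poly5.add (Poly5.add (Poly5.mulVar 0 (Poly5.deriv τ2 0 P)) (Poly5.mulVar 1 (Poly5.deriv τ2 1 P)))
    (Poly5.mulVar 2 (Poly5.deriv τ2 2 P))

/-- Linear Leray part `f = −Δu + ½u + ½(y·∇)u`, componentwise. -/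
def lin5 (τ2 : ℚ) (u : Fin 3 → Poly5) : Fin 3 → Poly5 := fun i =>
  Poly5.norm (Poly5.add (Poly5.add (Poly5.scale (-1) (lap5 τ2 (u i))) (Poly5.scale (1 / 2) (u i)))
    (Poly5.scale (1 / 2) (ydot5 τ2 (u i))))

/-- Nonlinear part `n_i = Σ_j u_j ∂_j u_i`. -/
def conv5 (τ2 : ℚ) (u : Fin 3 → Poly5) : Fin 3 → Poly5 := fun i =>
  Poly5.norm (Poly5.add (Poly5.add (Poly5.mul (u 0) (Poly5.deriv τ2 0 (u i)))
    (Poly5.mul (u 1) (Poly5.deriv τ2 1 (u i)))) (Poly5.mul (u 2) (Poly5.deriv τ2 2 (u i))))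

/-! ## The normal form (`y₃² → t − y₁² − y₂²`, `t·v² → τ²(1 − v²)`) and `t`-expansion -/

namespace Mono5

/-- One rewrite step: `none` if the monomial is already normal (`e3 ≤ 1` and (`et = 0` or `eh ≤ 1`)). -/
def nfStep (τ2 : ℚ) (m : Mono5) : Option Poly5 :=
  if 2 ≤ m.e3 then
    some [{ m with e3 := m.e3 - 2, et := m.et + 1 }, { m with e3 := m.e3 - 2, e1 := m.e1 + 2, c := -m.c },
      { m with e3 := m.e3 - 2, e2 := m.e2 + 2, c := -m.c }]
  else if 1 ≤ m.et ∧ 2 ≤ m.eh then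
    some [{ m with et := m.et - 1, eh := m.eh - 2, c := τ2 * m.c }, { m with et := m.et - 1, c := -(τ2 * m.c) }]
  else none

end Mono5

namespace Poly5

/-- Normal form with fuel (value-preserving for any fuel; complete for fuel ≥ max (e3 + 2·et)). -/
def nf (τ2 : ℚ) : ℕ → Poly5 → Poly5
  | 0, P => P
  | fuel + 1, P => P.flatMap fun m =>
      match m.nfStep τ2 with
      | none => [m]
      | some Q => nf τ2 fuel Q

/-- `t = y₁² + y₂² + y₃²` as a 5-polynomial. -/
def tPoly5 : Poly5 := [⟨2, 0, 0, 0, 0, 1⟩, ⟨0, 2, 0, 0, 0, 1⟩, ⟨0, 0, 2, 0, 0, 1⟩]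

/-- `t^n` expanded in `y` (normalised). -/
def tPow (n : ℕ) : Poly5 := Nat.rec [⟨0, 0, 0, 0, 0, 1⟩] (fun _ P => nmul P tPoly5) n

/-- Expand every `t^et` into `y`-monomials (so that `et = 0` throughout). -/
def expandT (P : Poly5) : Poly5 :=
  norm (P.flatMap fun m => (tPow m.et).map (Mono5.mul { m with et := 0 }))

end Poly5

/-! ## Exact moments `∫ y^a v^h dy` -/

/-- `Γ(n/2)/π^{[n odd]/2}` as a rational: `(n/2 − 1)!` for even `n`, `∏_{j<(n−1)/2} (j + ½)` for odd `n`. -/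
def ghalf (n : ℕ) : ℚ :=
  if n % 2 = 0 then ((n / 2 - 1).factorial : ℚ)
  else (List.range ((n - 1) / 2)).foldl (fun acc j => acc * ((2 * (j : ℚ) + 1) / 2)) 1

/-- Absolute convergence of `∫ |y^a| v^h` over `ℝ³`: `h > |a| + 3` (for a `t`-free monomial). -/
def Mono5.conv (m : Mono5) : Bool := decide (m.e1 + m.e2 + m.e3 + 3 < m.eh) && decide (m.et = 0)

/-- The rational factor of `∫ c y^a v^h dy` (`× π²` if `h` is even, `× π` if `h` is odd):
`c · Πᵢ ghalf(aᵢ+1) · τ^{|a|+3} · ghalf(h − |a| − 3) / ghalf(h)`, and `0` if some `aᵢ` is odd. -/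
def Mono5.momentQ (τ : ℚ) (m : Mono5) : ℚ :=
  if m.e1 % 2 = 1 ∨ m.e2 % 2 = 1 ∨ m.e3 % 2 = 1 then 0 else
    m.c * ghalf (m.e1 + 1) * ghalf (m.e2 + 1) * ghalf (m.e3 + 1) * τ ^ (m.e1 + m.e2 + m.e3 + 3) *
      ghalf (m.eh - (m.e1 + m.e2 + m.e3 + 3)) / ghalf m.eh

/-- `∫ P dy = c₁·π + c₂·π²` as the pair `(c₁, c₂)`, or `none` if some (t-expanded) monomial diverges. -/
def Poly5.integrate (τ : ℚ) (P : Poly5) : Option (ℚ × ℚ) :=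
  let E := Poly5.expandT P
  if E.all Mono5.conv then
    some (E.foldl (fun acc m => if m.eh % 2 = 1 then (acc.1 + m.momentQ τ, acc.2) else (acc.1, acc.2 + m.momentQ τ))
      (0, 0))
  else none

/-- Rational enclosure of `π`. -/
def piLo : ℚ := 3141592653589793 / 10 ^ 15
/-- see `piLo` -/
def piHi : ℚ := 3141592653589794 / 10 ^ 15

/-- Certified lower bound of `c₁π + c₂π²` (termwise by sign). -/
def encLo (c : ℚ × ℚ) : ℚ :=
  (if 0 ≤ c.1 then c.1 * piLo else c.1 * piHi) + (if 0 ≤ c.2 then c.2 * piLo ^ 2 else c.2 * piHi ^ 2)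

/-- Certified upper bound of `c₁π + c₂π²` (termwise by sign). -/
def encHi (c : ℚ × ℚ) : ℚ :=
  (if 0 ≤ c.1 then c.1 * piHi else c.1 * piLo) + (if 0 ≤ c.2 then c.2 * piHi ^ 2 else c.2 * piLo ^ 2)

/-! ## The two weights -/

/-- `t^n` as a single monomial. -/
def tMono (n : ℕ) (c : ℚ) : Mono5 := ⟨0, 0, 0, n, 0, c⟩

/-- Level floor `φ = NF[(1 − (t/100)^m)(1 − (1 − v²)^k)^m]` (`≤ 𝟙_{B₁₀}` pointwise). -/
def floorPoly (τ2 : ℚ) (m k : ℕ) : Poly5 :=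
  let one : Poly5 := [⟨0, 0, 0, 0, 0, 1⟩]
  let a : Poly5 := Poly5.add one [tMono m (-(1 / 100 ^ m))]
  let omw : Poly5 := [⟨0, 0, 0, 0, 0, 1⟩, ⟨0, 0, 0, 0, 2, -1⟩]
  let q : Poly5 := Nat.rec one (fun _ P => Poly5.nmul P omw) k
  let b : Poly5 := Poly5.sub one q
  let bb : Poly5 := Nat.rec one (fun _ P => Poly5.nmul P b) m
  Poly5.norm (Poly5.nf τ2 (4 * (m + k * m) + 8) (Poly5.nmul a bb))

/-- Even weight majorant `m = 1 + 10t + 5t² + 5B₁ + 10B₃ + B₅`, `B_j = (r_j t^{(j−1)/2} + t^{(j+1)/2}/r_j)/2`. -/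
def majorPoly (r1 r3 r5 : ℚ) : Poly5 :=
  Poly5.norm [tMono 0 1, tMono 1 10, tMono 2 5,
    tMono 0 (5 * r1 / 2), tMono 1 (5 / (2 * r1)),
    tMono 1 (10 * r3 / 2), tMono 2 (10 / (2 * r3)),
    tMono 2 (r5 / 2), tMono 3 (1 / (2 * r5))]

/-! ## Rows and the check -/

/-- An E-exact WITNESS ROW of the Type-I-tail class: scale `τ`, symbolic vector potential `Ψ`
(5-monomial lists), floor parameters, majorant radii, claimed level floor `M` and residual ceiling `δ`. -/
structure AlgRow where
  /-- kernel scale `τ` (`v = (1+|y|²/τ²)^{−1/2}`); rational so that `τ^{odd}` is -/ tau : ℚ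
  /-- the three components of the symbolic vector potential `Ψ` -/ psi : Fin 3 → Poly5
  /-- floor exponent `m` -/ mF : ℕ
  /-- floor exponent `k` -/ kF : ℕ
  /-- AM-GM radius for `ρ¹` -/ r1 : ℚ
  /-- AM-GM radius for `ρ³` -/ r3 : ℚ
  /-- AM-GM radius for `ρ⁵` -/ r5 : ℚ
  /-- claimed level floor `M ≤ ‖curl U‖_{L²(B₁₀)}` -/ M : ℚ
  /-- claimed residual ceiling `‖(1+ρ)^{5/2} g‖_{L²} ≤ δ` -/ δ : ℚ

namespace AlgRow

/-- `τ²`. -/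
def tau2 (r : AlgRow) : ℚ := r.tau * r.tau
/-- `u`: `U = curl Ψ`. -/
def u (r : AlgRow) : Fin 3 → Poly5 := curl5 r.tau2 r.psi
/-- `ω = curl u`. -/
def om (r : AlgRow) : Fin 3 → Poly5 := curl5 r.tau2 r.u
/-- `g = curl f + curl n`, the symbolic vorticity residual. -/
def g (r : AlgRow) : Fin 3 → Poly5 := fun i =>
  Poly5.add (curl5 r.tau2 (lin5 r.tau2 r.u) i) (curl5 r.tau2 (conv5 r.tau2 r.u) i)
/-- A fuel bound for the normal form of `g`. -/
def fuel (r : AlgRow) : ℕ := (List.foldl (fun acc m => max acc (m.e3 + 2 * m.et + 2)) 0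
  (r.g 0 ++ r.g 1 ++ r.g 2))
/-- `gNF`: normal form of `g`. -/
def gNF (r : AlgRow) : Fin 3 → Poly5 := fun i => Poly5.norm (Poly5.nf r.tau2 r.fuel (r.g i))
/-- Level integrand `φ·|ω|²`. -/
def levPoly (r : AlgRow) : Poly5 :=
  Poly5.nmul (floorPoly r.tau2 r.mF r.kF)
    (Poly5.add (Poly5.add (Poly5.nmul (r.om 0) (r.om 0)) (Poly5.nmul (r.om 1) (r.om 1))) (Poly5.nmul (r.om 2) (r.om 2)))
/-- Residual integrand `m·|gNF|²`. -/
def resPoly (r : AlgRow) : Poly5 :=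
  Poly5.nmul (majorPoly r.r1 r.r3 r.r5)
    (Poly5.add (Poly5.add (Poly5.nmul (r.gNF 0) (r.gNF 0)) (Poly5.nmul (r.gNF 1) (r.gNF 1)))
      (Poly5.nmul (r.gNF 2) (r.gNF 2)))
/-- `lev2 = ∫ φ|ω|²` as `(c₁, c₂)` (or `none`). -/
def lev2 (r : AlgRow) : Option (ℚ × ℚ) := Poly5.integrate r.tau r.levPoly
/-- `res2 = ∫ m|gNF|²` as `(c₁, c₂)` (or `none`). -/
def res2 (r : AlgRow) : Option (ℚ × ℚ) := Poly5.integrate r.tau r.resPoly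

/-- **The total Boolean check of a Type-I-tail witness row** (exact rational arithmetic). -/
def check (r : AlgRow) : Bool :=
  decide (0 < r.tau) && decide (0 < r.r1) && decide (0 < r.r3) && decide (0 < r.r5) && decide (1 ≤ r.mF) &&
    decide (0 ≤ r.M) && decide (0 ≤ r.δ) &&
    (match r.lev2, r.res2 with
      | some L, some R => decide (r.M * r.M ≤ encLo L) && decide (encHi R ≤ r.δ * r.δ)
      | _, _ => false)

end AlgRow

/-- A table of rows (one data module per certification pass). -/
abbrev AlgTable := List AlgRow

/-- Every row passes. -/
def AlgTable.check (T : AlgTable) : Bool := T.all AlgRow.check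

end Summit.NavierStokesRegularity.NavierStokesRegularity.Cruxes.ScarEnvelopeTypeI.ForcedTsai
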